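import Literature.GroupTheory.CombinatorialGroupTheory.FreeGroupCyclicConjugacyAbelian
import HarnessLib

/-!
# Free groups are cyclic conjugacy separable

Topic `Literature/GroupTheory/CombinatorialGroupTheory`; theorems only.  **Theorem** (J. L. Dyer,
*Separating conjugates in amalgamated free products and HNN extensions*, J. Austral. Math. Soc. (A)
29 (1980), Lemma 8 p. 47 — there in the form "separated by some projection `G → G/γ_c G`", which
together with her Lemma 6 (finitely generated nilpotent groups) gives the finite form; the finite form
is C. Y. Tang's notion *cyclic conjugacy separable*, J. Pure Appl. Algebra 1997, Def. 2.3, recorded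
there for free groups after Dyer): *let `F` be a free group, `x ∈ F` and `H = ⟨h⟩` a cyclic subgroup
such that no conjugate of `x` lies in `H`; then there is a homomorphism of `F` onto a finite group
under which no conjugate of the image of `x` lies in the image of `H`* — for `F(ι)` with an
ARBITRARY type `ι` of generators:

* `FreeGroup.exists_normal_finiteIndex_forall_not_isConj_zpow` — a normal subgroup `K` of finite
  index with `x̄ ≁ h̄ⁿ` in `F ⧸ K` for EVERY `n ∈ ℤ` (one `K` for all powers);
* `FreeGroup.exists_hom_finite_forall_not_isConj_zpow` — Dyer's/Tang's surjection form;
* `FreeGroup.cyclicConjugacySeparable` — the set form: `{x}^F ∩ ⟨h⟩ = ∅` implies the same for the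
  images in some finite quotient `F ⧸ K`.

This is the first of the separability inputs ("`A`, `B` cyclic conjugacy separable") of the
finite-amalgam route to the conjugacy separability of free products of two free groups with cyclic
amalgamation (Dyer 1980, Thm. 10; Tang 1997, Lemma 2.4), hence of orientable surface groups
`S_g ≅ F_{2g-2} *_ℤ F_2` (Stebe 1972, Thm. 3.3 — the tree's named fact
`SurfaceGroupConjugacySeparable`, input «[Stb2]» of Mochizuki, IUTchI, Thm. 2.6).  Nothing about that
fact is claimed here.

## Proof (an `n`-uniform version of the Baumslag–Taylor / Lyndon–Schupp I.4.8 descent, over the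
tree's engine `SchreierIndexTwo` / `FreeGroupExponentSums` / `FreeGroupConjugacySeparable`)

Induction on `‖x‖ + ‖h‖`.  Write `σⱼ : F → ℤ` for the exponent sums.
(A) If some `σⱼ₀(h) = b ≠ 0`, the exponent `n` is PINNED by abelian quotients: if `b ∤ σⱼ₀(x)` the
quotient `σⱼ₀ mod |b|` separates `x` from all of `⟨h⟩`; if `σⱼ₀(x) = n₀ b` but `σⱼ(x) ≠ n₀ σⱼ(h)` for
some `j`, the quotient `(σⱼ₀ mod 2|b||d|, σⱼ mod 2|d|)` does (`d = σⱼ(x) − n₀ σⱼ(h)`); and if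
`σⱼ(x) = n₀ σⱼ(h)` for all `j`, the free-group conjugacy separability of the tree separates `x`
from the single power `h^{n₀}` in some `F ⧸ K₁`, while `σⱼ₀ mod |b|·N₁` (`N₁` the order of `h̄` in
`F ⧸ K₁`) forces `n ≡ n₀ (mod N₁)`, i.e. `h̄ⁿ = h̄^{n₀}` in `F ⧸ K₁`.
(B) If all `σⱼ(h) = 0` but some `σⱼ(x) ≠ 0`, the quotient `σⱼ mod (|σⱼ(x)| + 1)` works.
(C) If all exponent sums of `x` and `h` vanish, `x ≠ 1` has a letter `x₁`; the parity homomorphism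
`λ` of the indicator of `x₁` kills `x` and `h`, and with `N = ker λ ≅ F(Y)` (Reidemeister–Schreier,
`SchreierIndexTwo`): `x ~_F hⁿ` iff `x* ~_N hⁿ` or `x* ~_N (x₁ h x₁⁻¹)ⁿ` for the short conjugate `x*`
of `x` (`‖ρ(x*)‖ < ‖x‖`, `‖ρ(h)‖, ‖ρ(x₁hx₁⁻¹)‖ ≤ ‖h‖`); the induction hypothesis in `F(Y)` gives ONE
`K₀` resp. `K₁` good for all `n`, and the normal core of the pull-back of `K₀ ⊓ K₁` works, by the
coset argument of Lyndon–Schupp verbatim.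

## References

* J. L. Dyer, *Separating conjugates in amalgamated free products and HNN extensions*, J. Austral.
  Math. Soc. Ser. A 29 (1980) 35–51, Lemma 8 (with Lemma 6), Thm. 10. [Dyer1980]
* C. Y. Tang, *Conjugacy separability of generalized free products of surface groups*, J. Pure
  Appl. Algebra (1997), Def. 2.3, Lemma 2.4. [Tang1997]
* R. C. Lyndon, P. E. Schupp, *Combinatorial Group Theory*, Springer (1977); Classics in
  Mathematics (2001), Ch. I Prop. 4.8 (the descent). [LyndonSchupp2001]
-/

namespace Literature.GroupTheory.CombinatorialGroupTheory

universe u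

namespace FreeGroupCyclicConjugacySeparable

open SchreierIndexTwo FreeGroupConjugacySeparable

section Step

variable {ι : Type u} (c : ι → ZMod 2) (x₁ : ι)

local notation3 "Q" => Multiplicative (ZMod 2)

local notation3 "Λ" => (FreeGroup.lift fun i => Multiplicative.ofAdd (c i) :
  FreeGroup ι →* Multiplicative (ZMod 2))

set_option quotPrecheck false in
local notation3 "sec" => fun (q : Multiplicative (ZMod 2)) =>
  (if q = 1 then (1 : FreeGroup ι) else FreeGroup.of x₁)

variable [DecidableEq ι]

local notation3 "Y" => {p : Multiplicative (ZMod 2) × ι // p ≠ (1, x₁)}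

set_option quotPrecheck false in
local notation3 "gen" => fun (q : Multiplicative (ZMod 2)) (i : ι) =>
  (if h : (q, i) = ((1 : Multiplicative (ZMod 2)), x₁) then (1 : FreeGroup Y)
    else FreeGroup.of (⟨(q, i), h⟩ : Y))

set_option quotPrecheck false in
local notation3 "Ψ" => (FreeGroup.lift fun i : ι =>
  (RegularWreathProduct.mk (fun q => gen q i) (Multiplicative.ofAdd (c i)) :
    FreeGroup Y ≀ᵣ Multiplicative (ZMod 2)))

set_option quotPrecheck false in
local notation3 "ev" => (FreeGroup.lift fun y : Y =>
  sec (Prod.fst (Subtype.val y)) * FreeGroup.of (Prod.snd (Subtype.val y)) *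
    (sec (Prod.fst (Subtype.val y) * Multiplicative.ofAdd (c (Prod.snd (Subtype.val y)))))⁻¹)

variable {c x₁}

/-- `ℤ/2` has the two elements `0` and `1`. [folklore] -/
private theorem eq_one_or_eq_ofAdd_one' (q : Q) : q = 1 ∨ q = Multiplicative.ofAdd 1 := by
  revert q; decide

/-- **The descent step, uniformly in the exponent**: given the conclusion for all pairs of smaller
total length (in all free groups `F(ι')`, `ι'` in the same universe), a parity homomorphism `λ`
killing `x` and `h`, and a letter `x₁` of `x` with `λ x₁ = 1`, there is ONE normal subgroup of finite
index of `F` modulo which `x` is conjugate to no power of `h` (Lyndon–Schupp's I.4.8 coset argument,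
with `v := hⁿ` and `x₁ v x₁⁻¹ = (x₁ h x₁⁻¹)ⁿ` for every `n` at once).
[cite: Dyer1980, Lemma 8 p.47] -/
theorem stepCyclic {n : ℕ}
    (IH : ∀ {ι' : Type u} [DecidableEq ι'] (x' h' : FreeGroup ι'),
      FreeGroup.norm x' + FreeGroup.norm h' ≤ n → (∀ k : ℤ, ¬ IsConj x' (h' ^ k)) →
      ∃ (K : Subgroup (FreeGroup ι')) (_ : K.Normal), K.FiniteIndex ∧
        ∀ k : ℤ, ¬ IsConj (QuotientGroup.mk x' : FreeGroup ι' ⧸ K) (QuotientGroup.mk (h' ^ k)))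
    {x h : FreeGroup ι} (hle : FreeGroup.norm x + FreeGroup.norm h ≤ n + 1)
    (hxh : ∀ k : ℤ, ¬ IsConj x (h ^ k))
    (hx : c x₁ = 1) (hΛx : Λ x = 1) (hΛh : Λ h = 1) (hmem : x₁ ∈ x.toWord.map Prod.fst) :
    ∃ (K : Subgroup (FreeGroup ι)) (_ : K.Normal), K.FiniteIndex ∧
      ∀ k : ℤ, ¬ IsConj (QuotientGroup.mk x : FreeGroup ι ⧸ K) (QuotientGroup.mk (h ^ k)) := by
  -- the short conjugate `x*` and the partner `h₁ = x₁ h x₁⁻¹`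
  obtain ⟨us, hus, hus_par, hus_norm⟩ := exists_isConj_norm_left_psi_lt hx hΛx hmem
  set h₁ : FreeGroup ι := FreeGroup.of x₁ * h * (FreeGroup.of x₁)⁻¹ with hh₁
  have hh₁_par : Λ h₁ = 1 := by
    rw [hh₁, _root_.map_mul, _root_.map_mul, hΛh, mul_one, _root_.map_inv, mul_inv_cancel]
  have hh₁_left : (Ψ h₁).left 1 = (Ψ h).left (Multiplicative.ofAdd 1) := left_psi_conj hx hΛh
  -- the Reidemeister–Schreier isomorphism `ρ : N ≃* F(Y)`, `N = ker λ`
  let N : Subgroup (FreeGroup ι) := (Λ).ker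
  have hmemN : ∀ {g : FreeGroup ι}, g ∈ N ↔ Λ g = 1 := fun {g} => MonoidHom.mem_ker
  let ρ : N ≃* FreeGroup Y :=
    { toFun := fun g => (Ψ (g : FreeGroup ι)).left 1
      invFun := fun w => ⟨ev w, hmemN.mpr (parity_ev hx w)⟩
      left_inv := fun g => Subtype.ext (ev_left_psi_of_mem_ker hx (hmemN.mp g.2))
      right_inv := fun w => left_psi_ev hx w
      map_mul' := fun g h => by
        simp only [Subgroup.coe_mul]
        exact left_psi_mul_of_mem_ker (hmemN.mp g.2) _ }
  have hρ : ∀ g : N, ρ g = (Ψ (g : FreeGroup ι)).left 1 := fun g => rfl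
  -- rewriting commutes with powers on `N`
  have hpow : ∀ (g : FreeGroup ι) (hg : Λ g = 1) (k : ℤ),
      (Ψ (g ^ k)).left 1 = ((Ψ g).left 1) ^ k := by
    intro g hg k
    have hgN : g ∈ N := hmemN.mpr hg
    have h1 := map_zpow ρ ⟨g, hgN⟩ k
    rw [hρ, hρ, Subgroup.coe_zpow] at h1
    exact h1
  have hzpow_par : ∀ (g : FreeGroup ι), Λ g = 1 → ∀ k : ℤ, Λ (g ^ k) = 1 := fun g hg k => by
    rw [map_zpow, hg, one_zpow]
  -- non-conjugacy of the rewritings, for every exponent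
  have hnc₀ : ∀ k : ℤ, ¬ IsConj ((Ψ us).left 1) (((Ψ h).left 1) ^ k) := fun k hk => by
    rw [← hpow h hΛh k] at hk
    exact hxh k (hus.trans (isConj_of_isConj_left_psi hx hus_par (hzpow_par h hΛh k) hk))
  have hnc₁ : ∀ k : ℤ, ¬ IsConj ((Ψ us).left 1) (((Ψ h₁).left 1) ^ k) := fun k hk => by
    rw [← hpow h₁ hh₁_par k] at hk
    have h1 : IsConj us (h₁ ^ k) := isConj_of_isConj_left_psi hx hus_par (hzpow_par h₁ hh₁_par k) hk
    have h2 : h₁ ^ k = FreeGroup.of x₁ * h ^ k * (FreeGroup.of x₁)⁻¹ := by rw [hh₁]; exact conj_zpow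
    exact hxh k ((hus.trans h1).trans (isConj_iff.mpr ⟨(FreeGroup.of x₁)⁻¹, by rw [h2]; group⟩))
  -- induction hypothesis in `F(Y)`
  have hm₀ : FreeGroup.norm ((Ψ us).left 1) + FreeGroup.norm ((Ψ h).left 1) ≤ n := by
    have := norm_left_psi_le (c := c) (x₁ := x₁) h 1; omega
  have hm₁ : FreeGroup.norm ((Ψ us).left 1) + FreeGroup.norm ((Ψ h₁).left 1) ≤ n := by
    have := norm_left_psi_le (c := c) (x₁ := x₁) h (Multiplicative.ofAdd 1)
    rw [hh₁_left]; omega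
  obtain ⟨K₀, hK₀n, hK₀f, hK₀⟩ := IH _ _ hm₀ hnc₀
  obtain ⟨K₁, hK₁n, hK₁f, hK₁⟩ := IH _ _ hm₁ hnc₁
  -- `K' = K₀ ⊓ K₁`
  set K' : Subgroup (FreeGroup Y) := K₀ ⊓ K₁ with hK'
  haveI : K'.Normal := inferInstance
  haveI : K'.FiniteIndex := inferInstance
  -- pull `K'` back to `F` and take the normal core
  let L : Subgroup (FreeGroup ι) := (K'.comap ρ.toMonoidHom).map N.subtype
  haveI hNf : N.FiniteIndex := by
    haveI : Finite (Λ).range := inferInstance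
    exact Subgroup.finiteIndex_ker _
  haveI hLf : L.FiniteIndex := by
    constructor
    rw [Subgroup.index_map, N.ker_subtype, sup_bot_eq, N.range_subtype,
      Subgroup.index_comap_of_surjective _ ρ.surjective]
    exact mul_ne_zero Subgroup.FiniteIndex.index_ne_zero hNf.index_ne_zero
  let M : Subgroup (FreeGroup ι) := L.normalCore
  have hML : M ≤ L := Subgroup.normalCore_le L
  -- membership in `L`: an element of `N` whose rewriting lies in `K'`
  have hmemL : ∀ {g : FreeGroup ι} (hg : g ∈ N), g ∈ L → ρ ⟨g, hg⟩ ∈ K' := by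
    intro g hg hgL
    obtain ⟨m, hm, hmg⟩ := Subgroup.mem_map.mp hgL
    have : m = ⟨g, hg⟩ := Subtype.ext hmg
    rw [← this]
    exact Subgroup.mem_comap.mp hm
  refine ⟨M, inferInstance, inferInstance, fun k hc => ?_⟩
  -- the partners `v := h ^ k`, `v₁ := x₁ v x₁⁻¹ = h₁ ^ k`
  set v : FreeGroup ι := h ^ k with hv
  have hv_par : Λ v = 1 := hzpow_par h hΛh k
  set v₁ : FreeGroup ι := FreeGroup.of x₁ * v * (FreeGroup.of x₁)⁻¹ with hv₁
  have hv₁_eq : v₁ = h₁ ^ k := by rw [hv₁, hv, hh₁, conj_zpow]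
  have hv₁_par : Λ v₁ = 1 := by rw [hv₁_eq]; exact hzpow_par h₁ hh₁_par k
  have hρv : ∀ (hvN : v ∈ N), ρ ⟨v, hvN⟩ = ((Ψ h).left 1) ^ k := fun hvN => by
    rw [hρ]; exact hpow h hΛh k
  have hρv₁ : ∀ (hv₁N : v₁ ∈ N), ρ ⟨v₁, hv₁N⟩ = ((Ψ h₁).left 1) ^ k := fun hv₁N => by
    rw [hρ]; change (Ψ v₁).left 1 = _; rw [hv₁_eq]; exact hpow h₁ hh₁_par k
  have hK'₀ : ¬ IsConj (QuotientGroup.mk ((Ψ us).left 1) : FreeGroup Y ⧸ K')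
      (QuotientGroup.mk (((Ψ h).left 1) ^ k)) := fun h' =>
    hK₀ k (isConj_mk_of_le (inf_le_left : K' ≤ K₀) h')
  have hK'₁ : ¬ IsConj (QuotientGroup.mk ((Ψ us).left 1) : FreeGroup Y ⧸ K')
      (QuotientGroup.mk (((Ψ h₁).left 1) ^ k)) := fun h' =>
    hK₁ k (isConj_mk_of_le (inf_le_right : K' ≤ K₁) h')
  -- transfer from `x` to `x*`
  have hc' : IsConj (QuotientGroup.mk us : FreeGroup ι ⧸ M) (QuotientGroup.mk v) :=
    (MonoidHom.map_isConj (QuotientGroup.mk' M) hus).symm.trans hc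
  obtain ⟨gbar, hg⟩ := isConj_iff.mp hc'
  obtain ⟨g, rfl⟩ := QuotientGroup.mk_surjective gbar
  -- `g x* g⁻¹ ≡ v (mod M)`
  have hrel : (g * us * g⁻¹)⁻¹ * v ∈ M := by
    rw [← QuotientGroup.eq]
    simpa only [QuotientGroup.mk_mul, QuotientGroup.mk_inv] using hg
  rcases eq_one_or_eq_ofAdd_one' (Λ g) with hg1 | hg1
  · -- `g ∈ N`: contradiction with `K₀`
    have ha : g * us * g⁻¹ ∈ N := by
      rw [hmemN, _root_.map_mul, _root_.map_mul, _root_.map_inv, hg1, hus_par]; simp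
    have hvN : v ∈ N := hmemN.mpr hv_par
    have hd : ρ ((⟨g * us * g⁻¹, ha⟩ : N)⁻¹ * ⟨v, hvN⟩) ∈ K' :=
      hmemL (N.mul_mem (N.inv_mem ha) hvN) (hML hrel)
    apply hK'₀
    rw [_root_.map_mul, _root_.map_inv] at hd
    have heq : (QuotientGroup.mk (ρ ⟨g * us * g⁻¹, ha⟩) : FreeGroup Y ⧸ K') =
        QuotientGroup.mk (ρ ⟨v, hvN⟩) := QuotientGroup.eq.mpr hd
    have hgN : g ∈ N := hmemN.mpr hg1
    have husN : us ∈ N := hmemN.mpr hus_par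
    have hsplit : (⟨g * us * g⁻¹, ha⟩ : N) = ⟨g, hgN⟩ * ⟨us, husN⟩ * ⟨g, hgN⟩⁻¹ :=
      Subtype.ext (by simp)
    rw [hsplit, _root_.map_mul, _root_.map_mul, _root_.map_inv, QuotientGroup.mk_mul,
      QuotientGroup.mk_mul, QuotientGroup.mk_inv] at heq
    rw [hρ ⟨us, husN⟩, hρv hvN] at heq
    exact isConj_iff.mpr ⟨_, heq⟩
  · -- `g ∈ x₁⁻¹ N`: with `m := x₁ g ∈ N`, `m x* m⁻¹ ≡ x₁ v x₁⁻¹`; contradiction with `K₁`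
    have hmN : FreeGroup.of x₁ * g ∈ N := by
      rw [hmemN, _root_.map_mul, FreeGroup.lift_apply_of, hx, hg1]; decide
    have ha : FreeGroup.of x₁ * g * us * (FreeGroup.of x₁ * g)⁻¹ ∈ N := by
      rw [hmemN, _root_.map_mul, _root_.map_mul, _root_.map_inv, (hmemN).mp hmN, hus_par]; simp
    have hv₁N : v₁ ∈ N := hmemN.mpr hv₁_par
    have hrel' : (FreeGroup.of x₁ * g * us * (FreeGroup.of x₁ * g)⁻¹)⁻¹ * v₁ ∈ M := by
      have : (FreeGroup.of x₁ * g * us * (FreeGroup.of x₁ * g)⁻¹)⁻¹ * v₁ =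
          FreeGroup.of x₁ * ((g * us * g⁻¹)⁻¹ * v) * (FreeGroup.of x₁)⁻¹ := by
        rw [hv₁]; group
      rw [this]
      exact (inferInstance : M.Normal).conj_mem _ hrel _
    have hd : ρ ((⟨_, ha⟩ : N)⁻¹ * ⟨v₁, hv₁N⟩) ∈ K' :=
      hmemL (N.mul_mem (N.inv_mem ha) hv₁N) (hML hrel')
    apply hK'₁
    rw [_root_.map_mul, _root_.map_inv] at hd
    have heq : (QuotientGroup.mk (ρ ⟨_, ha⟩) : FreeGroup Y ⧸ K') =
        QuotientGroup.mk (ρ ⟨v₁, hv₁N⟩) := QuotientGroup.eq.mpr hd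
    have husN : us ∈ N := hmemN.mpr hus_par
    have hsplit : (⟨_, ha⟩ : N) = ⟨_, hmN⟩ * ⟨us, husN⟩ * ⟨_, hmN⟩⁻¹ :=
      Subtype.ext (by simp)
    rw [hsplit, _root_.map_mul, _root_.map_mul, _root_.map_inv, QuotientGroup.mk_mul,
      QuotientGroup.mk_mul, QuotientGroup.mk_inv] at heq
    rw [hρ ⟨us, husN⟩, hρv₁ hv₁N] at heq
    exact isConj_iff.mpr ⟨_, heq⟩

end Step

/-! ### The theorem -/

section Main

variable {ι : Type u} [DecidableEq ι]

set_option quotPrecheck false in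
local notation3 "σ" => fun (j : ι) => (FreeGroup.lift fun i : ι =>
  (if i = j then Multiplicative.ofAdd (1 : ℤ) else (1 : Multiplicative ℤ)) :
    FreeGroup ι →* Multiplicative ℤ)

set_option quotPrecheck false in
local notation3 "Λ" => fun (c : ι → ZMod 2) => (FreeGroup.lift fun i => Multiplicative.ofAdd (c i) :
  FreeGroup ι →* Multiplicative (ZMod 2))

/-- Reduction mod `2` of the exponent sum `σₐ` is the parity homomorphism of the indicator of `a`.
[folklore] -/
private theorem castHom_comp_expSum' (a : ι) :
    (AddMonoidHom.toMultiplicative (Int.castAddHom (ZMod 2))).comp (σ a) =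
      Λ (fun i => if i = a then 1 else 0) := by
  refine FreeGroup.ext_hom _ _ (fun i => ?_)
  rw [MonoidHom.comp_apply, FreeGroup.lift_apply_of, FreeGroup.lift_apply_of]
  by_cases h : i = a
  · subst h; simp
  · simp [h]

/-- The parity homomorphism of the indicator of `a` kills every element with `σₐ = 0`. [folklore] -/
private theorem parity_eq_one_of_expSum_eq_one (a : ι) {g : FreeGroup ι} (hg : σ a g = 1) :
    Λ (fun i => if i = a then 1 else 0) g = 1 := by
  rw [← castHom_comp_expSum' a, MonoidHom.comp_apply, hg, _root_.map_one]

end Main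

/-- The induction on `‖x‖ + ‖h‖`. [cite: Dyer1980, Lemma 8 p.47] -/
theorem aux (n : ℕ) : ∀ {ι : Type u} [DecidableEq ι] (x h : FreeGroup ι),
    FreeGroup.norm x + FreeGroup.norm h ≤ n → (∀ k : ℤ, ¬ IsConj x (h ^ k)) →
      ∃ (K : Subgroup (FreeGroup ι)) (_ : K.Normal), K.FiniteIndex ∧
        ∀ k : ℤ, ¬ IsConj (QuotientGroup.mk x : FreeGroup ι ⧸ K) (QuotientGroup.mk (h ^ k)) := by
  induction n with
  | zero =>
      intro ι _ x h hle hxh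
      exfalso
      have hx : x = 1 := FreeGroup.norm_eq_zero.mp (by omega)
      exact hxh 0 (by rw [hx, zpow_zero])
  | succ n IH =>
      intro ι _ x h hle hxh
      -- (A): some exponent sum of `h` is non-zero
      by_cases hA : ∃ j : ι, (FreeGroup.lift fun i : ι =>
          (if i = j then Multiplicative.ofAdd (1 : ℤ) else (1 : Multiplicative ℤ))) h ≠ 1
      · obtain ⟨j₀, hj₀⟩ := hA
        exact sep_of_expSum_h_ne_one j₀ hj₀ hxh
      push Not at hA
      -- (B): all exponent sums of `h` vanish, some exponent sum of `x` does not
      by_cases hB : ∃ j : ι, (FreeGroup.lift fun i : ι =>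
          (if i = j then Multiplicative.ofAdd (1 : ℤ) else (1 : Multiplicative ℤ))) x ≠ 1
      · obtain ⟨j, hj⟩ := hB
        exact sep_of_expSum_h_trivial j (hA j) hj
      push Not at hB
      -- (C): all exponent sums vanish — descent along the indicator parity of a letter of `x`
      have hx1 : x ≠ 1 := fun h1 => hxh 0 (by rw [h1, zpow_zero])
      obtain ⟨p, hp⟩ : ∃ p, p ∈ x.toWord := by
        rcases hw : x.toWord with _ | ⟨p, L⟩
        · exact absurd (FreeGroup.toWord_eq_nil_iff.mp hw) hx1
        · exact ⟨p, List.mem_cons_self ..⟩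
      set x₁ : ι := p.1 with hx₁
      have hmem : x₁ ∈ x.toWord.map Prod.fst := List.mem_map.mpr ⟨p, hp, rfl⟩
      exact stepCyclic (c := fun i => if i = x₁ then 1 else 0) (x₁ := x₁)
        (fun x' h' h1 h2 => IH x' h' h1 h2) hle hxh (by simp)
        (parity_eq_one_of_expSum_eq_one x₁ (hB x₁)) (parity_eq_one_of_expSum_eq_one x₁ (hA x₁)) hmem

end FreeGroupCyclicConjugacySeparable

open FreeGroupCyclicConjugacySeparable in
/-- **Free groups are cyclic conjugacy separable** (Dyer 1980, Lemma 8 with Lemma 6; "cyclic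
conjugacy separable" in the sense of Tang 1997, Def. 2.3): if `x ∈ F(ι)` is conjugate to NO power of
`h ∈ F(ι)`, there is a normal subgroup `K` of finite index in `F(ι)` such that in the finite group
`F(ι) ⧸ K` the image of `x` is conjugate to no power of the image of `h` — one `K` for all exponents.
Here `ι` is arbitrary. [cite: Dyer1980, Lemma 8 p.47] -/
theorem _root_.FreeGroup.exists_normal_finiteIndex_forall_not_isConj_zpow {ι : Type u}
    {x h : FreeGroup ι} (hxh : ∀ n : ℤ, ¬ IsConj x (h ^ n)) :
    ∃ (K : Subgroup (FreeGroup ι)) (_ : K.Normal), K.FiniteIndex ∧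
      ∀ n : ℤ, ¬ IsConj (QuotientGroup.mk x : FreeGroup ι ⧸ K) (QuotientGroup.mk h ^ n) := by
  classical
  obtain ⟨K, hKn, hKf, hK⟩ := aux _ x h le_rfl hxh
  refine ⟨K, hKn, hKf, fun n => ?_⟩
  rw [← QuotientGroup.mk_zpow]
  exact hK n

/-- **Free groups are cyclic conjugacy separable**, surjection form (Dyer 1980, Lemma 8 / Tang 1997,
Def. 2.3: *"for each `x ∈ G` and each cyclic subgroup `⟨h⟩` of `G` such that `{x}^G ∩ ⟨h⟩ = ∅`, there
exists a finite homomorphic image `Ḡ` of `G` such that `{x̄}^Ḡ ∩ ⟨h̄⟩ = ∅`"*), for `G = F(ι)` free: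
a homomorphism ONTO a finite group under which the image of `x` is conjugate to no power of the
image of `h`. [cite: Dyer1980, Lemma 8 p.47] -/
theorem _root_.FreeGroup.exists_hom_finite_forall_not_isConj_zpow {ι : Type u} {x h : FreeGroup ι}
    (hxh : ∀ n : ℤ, ¬ IsConj x (h ^ n)) :
    ∃ (Q : Type u) (_ : Group Q) (_ : Finite Q) (ξ : FreeGroup ι →* Q),
      Function.Surjective ξ ∧ ∀ n : ℤ, ¬ IsConj (ξ x) (ξ h ^ n) := by
  obtain ⟨K, hKn, hKf, hK⟩ := FreeGroup.exists_normal_finiteIndex_forall_not_isConj_zpow hxh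
  exact ⟨FreeGroup ι ⧸ K, inferInstance, Subgroup.finite_quotient_of_finiteIndex,
    QuotientGroup.mk' K, QuotientGroup.mk'_surjective K, hK⟩

/-- **Free groups are cyclic conjugacy separable**, set form: if no conjugate of `x` lies in the
cyclic subgroup `⟨h⟩` of `F(ι)`, then for some normal subgroup `K` of finite index no conjugate of
the image of `x` lies in the image of `⟨h⟩` in `F(ι) ⧸ K`. [cite: Dyer1980, Lemma 8 p.47] -/
theorem _root_.FreeGroup.cyclicConjugacySeparable {ι : Type u} {x h : FreeGroup ι}
    (hxh : ∀ g : FreeGroup ι, g * x * g⁻¹ ∉ Subgroup.zpowers h) :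
    ∃ (K : Subgroup (FreeGroup ι)) (_ : K.Normal), K.FiniteIndex ∧
      ∀ g : FreeGroup ι ⧸ K, g * QuotientGroup.mk x * g⁻¹ ∉
        (Subgroup.zpowers h).map (QuotientGroup.mk' K) := by
  have hxh' : ∀ n : ℤ, ¬ IsConj x (h ^ n) := by
    intro n hc
    obtain ⟨g, hg⟩ := isConj_iff.mp hc
    exact hxh g (hg ▸ Subgroup.zpow_mem_zpowers h n)
  obtain ⟨K, hKn, hKf, hK⟩ := FreeGroup.exists_normal_finiteIndex_forall_not_isConj_zpow hxh'
  refine ⟨K, hKn, hKf, fun g hg => ?_⟩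
  rw [MonoidHom.map_zpowers, Subgroup.mem_zpowers_iff] at hg
  obtain ⟨n, hn⟩ := hg
  exact hK n (isConj_iff.mpr ⟨g, hn.symm ▸ rfl⟩)

end Literature.GroupTheory.CombinatorialGroupTheory
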